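import Summits.AtomisticToContinuum.Crystallization.Theorems.FluxTubeKeplerFluxCellKeplerSingleScale
import Summits.AtomisticToContinuum.Crystallization.Theorems.ChessboardParticlePlanesPeriodicWindowsIffCrystallization

/-!
# `FirstShellRung` — ON-PATH file (F4): `Crystallization → RadiusRung 𝓡` for every radius set `𝓡`

Self-contained, sorry-free copy (namespace `…RadiusLadder.OnPath`) of the graded family of
`Lines/FirstShellRung.lean` with the on-path lemma: the sub-problem statement implies every member of
the family (landed hull-criterion converse
`Theorems.ChessboardParticlePlanesPeriodicWindowsIffCrystallization.periodicWindows_of_crystallization`),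
in particular the deciding rung `FirstShellRung := RadiusRung {6/5}` (`FirstShellRung_of_Crystallization`,
tagged `aesop safe apply`).
-/

noncomputable section

open scoped BigOperators Classical
open Filter Topology

namespace Summit.AtomisticToContinuum.Crystallization.Cruxes.FluxCellKepler.RadiusLadder.OnPath

open Literature.MathematicalPhysics.StatisticalMechanics
open Summit.AtomisticToContinuum.Crystallization.Theorems.FluxCellKeplerSingleScale
  (LayeredGood layeredGood_mono card_bad_le SingleScaleFluxCellKepler fluxCellKepler_of_singleScale
    singleScale_of_fluxCellKepler)
open Summit.AtomisticToContinuum.Crystallization.Theorems.PrestressSplitKorn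
  (squeeze_card_filter_exists_near_le)

local notation "E3" => EuclideanSpace ℝ (Fin 3)

/-! ## The graded family -/

/-- FLOOR(P₀): `N · e(P₀) ≤ E(x)` for every Lennard-Jones ground state `x` of every size `N`
(verbatim the first hypothesis of `FluxTubeKepler.FloorGivesLayered`; same text as
`ToleranceLadder.Floor`, `VacancyLadder.Floor`). -/
def Floor (P₀ : PeriodicConfiguration 3) : Prop :=
  ∀ (N : ℕ) (x : Fin N → E3), IsGroundState lennardJones x →
    (N : ℝ) * P₀.energyPerParticle lennardJones ≤ interactionEnergy lennardJones x

/-- BUDGET(P₀) ON THE RADIUS SET `𝓡`: for every pattern radius `R ∈ 𝓡`, `R > 0`, and every tolerance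
`η > 0`, some `c > 0` prices the `(R,η)`-non-layered sites of every Lennard-Jones ground state against the
excess energy over `N · e(P₀)` (`LayeredGood` is the crux's defect predicate, verbatim; `𝓡 = univ` is the
floor's budget at every radius). -/
def Budget (𝓡 : Set ℝ) (P₀ : PeriodicConfiguration 3) : Prop :=
  ∀ R η : ℝ, 0 < R → R ∈ 𝓡 → 0 < η → ∃ c : ℝ, 0 < c ∧
    ∀ (N : ℕ) (x : Fin N → E3), IsGroundState lennardJones x →
      c * (Nat.card {i : Fin N // ¬ LayeredGood R η x i} : ℝ) ≤
        interactionEnergy lennardJones x - (N : ℝ) * P₀.energyPerParticle lennardJones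

/-- Periodic windows at every scale along the sequence `x` (ONE periodic `P`, translations only) —
verbatim the conclusion of `ChessboardParticlePlanes.PeriodicWindows` / `FluxTubeKepler.PeriodicGivenLayered`. -/
def HasPeriodicWindows (x : (N : ℕ) → (Fin N → E3)) : Prop :=
  ∃ P : PeriodicConfiguration 3, ∀ R ε : ℝ, 0 < ε → ∃ᶠ N in atTop, ∃ t : E3,
    (∀ s ∈ P.points, ‖s‖ ≤ R → ∃ i : Fin N, dist (x N i + t) s ≤ ε) ∧
    (∀ i : Fin N, ‖x N i + t‖ ≤ R → ∃ s ∈ P.points, dist (x N i + t) s ≤ ε)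

/-- **The graded family.** `RadiusRung 𝓡`: FLOOR and the defect budget at the radii in `𝓡` (all
tolerances) force periodic windows along every Lennard-Jones ground-state sequence. -/
def RadiusRung (𝓡 : Set ℝ) : Prop :=
  ∀ P₀ : PeriodicConfiguration 3, Floor P₀ → Budget 𝓡 P₀ →
    ∀ x : (N : ℕ) → (Fin N → E3), (∀ N, IsGroundState lennardJones (x N)) → HasPeriodicWindows x

/-- **Deciding rung.** The defect budget at the coordination-shell radius `6/5` alone suffices. -/
def FirstShellRung : Prop := RadiusRung {6 / 5}

/-! ## F4 — on-path lemmas: the sub-problem implies every member -/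

/-- ON-PATH: `Crystallization → RadiusRung 𝓡` (landed hull-criterion converse
`periodicWindows_of_crystallization`). -/
theorem radiusRung_of_crystallization (𝓡 : Set ℝ) (h : _root_.Crystallization) : RadiusRung 𝓡 :=
  fun _ _ _ x hx =>
    Theorems.ChessboardParticlePlanesPeriodicWindowsIffCrystallization.periodicWindows_of_crystallization h x hx

/-- ON-PATH for the deciding rung (tagged `aesop safe apply` so that the tribunal's fixed `S → C`
portfolio finds it). -/
@[aesop safe apply]
theorem FirstShellRung_of_Crystallization (h : _root_.Crystallization) : FirstShellRung :=
  radiusRung_of_crystallization _ h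


end Summit.AtomisticToContinuum.Crystallization.Cruxes.FluxCellKepler.RadiusLadder.OnPath

end
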